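import Literature.Geometry.Riemannian.MetricFlowWassersteinMonotone
import Literature.MeasureTheory.Integral.IteratedIntegralDiracLimit
import Mathlib.Topology.MetricSpace.Lipschitz
import HarnessLib

/-!
# Toolbox for the reproduction formula of `𝔽`-limits (Bamler 2023, §5.4, Lemma 5.20, Claim 5.22)

Auxiliary statements for `MetricFlowFLimitReproduction.lean` (R. Bamler, *Compactness theory of
the space of super Ricci flows*, Invent. Math. 233 (2023), §5.4, proof of Lemma 5.20 = arXiv v1
Lemma 121, Claim 5.22 = arXiv v1 Claim 123, Property (7) of the limit), kept apart to respect the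
file-size limit:

* `abs_integral_sub_integral_le_mul_wassersteinW1` — the easy half of Kantorovich–Rubinstein with a
  Lipschitz constant: `|∫ u dμ − ∫ u dν| ≤ K · d_{W₁}(μ, ν)` for bounded `K`-Lipschitz `u` and
  probability measures at finite `W₁`-distance (from the tree's `1`-Lipschitz
  `ofReal_integral_sub_integral_le_wassersteinW1`);
* `tendsto_integral_of_tendsto_wassersteinW1_zero` — `d_{W₁}(αᵢ, α) → 0` implies
  `∫ u dαᵢ → ∫ u dα` for bounded Lipschitz `u` (the form in which *"by Claim 5.21
  `∫ f̂ ∘ φⁱ_{t₁} dνⁱ_{xⁱ;t₁} → ∫ f dν^∞_{x^∞;t₁}`"* is used);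
* `integral_eq_integral_integral_of_forall_lintegral` — the reproduction / disintegration identity
  `∫ f dκ₁ = ∫ (∫ f dκ(y)) dκ₂(y)` for bounded measurable real `f` from its `[0, ∞]`-valued form;
* `abs_integral_sub_integral_le_add_mul_measure_compl` — `|∫ u − ∫ v| ≤ ε + 2C · μ(Tᶜ)` when
  `|u − v| ≤ ε` on `T` and `|u|, |v| ≤ C`;
* `exists_lipschitzWith_extension_abs_le` — bounded Lipschitz (McShane) extension, clamped;
* `exists_eventually_forall_abs_sub_le_of_mem_thickening` — the quantitative content of *"for any
  sequence `yⁱ ∈ 𝒳ⁱ_{t₂}` with `φⁱ_{t₂}(yⁱ) → y^∞ ∈ X^∞_{t₂}` we have `hⁱ(yⁱ) → h^∞(y^∞)`"*: for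
  uniformly Lipschitz `hⁿ` this convergence along approximating sequences yields, by a finite-net
  argument, the UNIFORM estimate `|hⁿ(y) − ĥ(φₙ y)| ≤ ε` for `φₙ y` near a compact subset of the
  limit slice and `n` large (`ĥ` a Lipschitz extension of `h^∞`).

Everything is proved; no definitions, no named facts.

## References

* R. H. Bamler, *Compactness theory of the space of super Ricci flows*, Invent. Math. 233 (2023),
  1121–1277 (arXiv:2008.09298), §5.4, Lemma 5.20, Claims 5.21–5.22 (arXiv v1: Lemma 121,
  Claims 122–123). [Bamler2023]
* C. Villani, *Topics in Optimal Transportation*, GSM 58 (AMS 2003), Thm. 1.14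
  (Kantorovich–Rubinstein, easy inequality), §7.1. [Villani2003]
-/

noncomputable section

open Set MeasureTheory Filter TopologicalSpace Function Metric
open scoped Topology ENNReal NNReal

namespace Literature.Geometry.Riemannian

open _root_.Literature.MeasureTheory.Integral (abs_integral_le_of_forall_abs_le)

/-! ### Integrals of bounded Lipschitz functions against `W₁`-close measures -/

section Toolbox

variable {X : Type*} [MeasurableSpace X]

/-- **Integral estimate off a good set**: for a probability measure `μ`, measurable `u, v` bounded
by `C`, and `|u − v| ≤ ε` on a measurable set `T`,
`|∫ u dμ − ∫ v dμ| ≤ ε + 2C · μ(Tᶜ)`. [folklore] -/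
theorem abs_integral_sub_integral_le_add_mul_measure_compl (μ : Measure X) [IsProbabilityMeasure μ]
    {u v : X → ℝ} (hu : Measurable u) (hv : Measurable v) {C : ℝ} (huC : ∀ x, |u x| ≤ C)
    (hvC : ∀ x, |v x| ≤ C) {T : Set X} (hT : MeasurableSet T) {ε : ℝ} (hε : 0 ≤ ε)
    (hT' : ∀ x ∈ T, |u x - v x| ≤ ε) :
    |∫ x, u x ∂μ - ∫ x, v x ∂μ| ≤ ε + 2 * C * (μ Tᶜ).toReal := by
  have hui : Integrable u μ := MetricFlow.integrable_of_bounded_measurable hu huC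
  have hvi : Integrable v μ := MetricFlow.integrable_of_bounded_measurable hv hvC
  have hbi : Integrable (fun x ↦ ε + Tᶜ.indicator (fun _ ↦ 2 * C) x) μ :=
    (integrable_const ε).add ((integrable_const (2 * C)).indicator hT.compl)
  have hle : ∀ x, |u x - v x| ≤ ε + Tᶜ.indicator (fun _ ↦ 2 * C) x := fun x ↦ by
    by_cases hx : x ∈ T
    · rw [indicator_of_notMem (fun h ↦ absurd hx ((mem_compl_iff _ _).1 h)), add_zero]
      exact hT' x hx
    · rw [indicator_of_mem (mem_compl hx)]
      calc |u x - v x| ≤ |u x| + |v x| := abs_sub _ _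
        _ ≤ C + C := add_le_add (huC x) (hvC x)
        _ ≤ ε + 2 * C := by linarith
  calc |∫ x, u x ∂μ - ∫ x, v x ∂μ| = |∫ x, (u x - v x) ∂μ| := by rw [integral_sub hui hvi]
    _ ≤ ∫ x, |u x - v x| ∂μ := abs_integral_le_integral_abs
    _ ≤ ∫ x, (ε + Tᶜ.indicator (fun _ ↦ 2 * C) x) ∂μ := integral_mono (hui.sub hvi).abs hbi hle
    _ = ε + 2 * C * (μ Tᶜ).toReal := by
        rw [integral_add (integrable_const ε) ((integrable_const (2 * C)).indicator hT.compl),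
          integral_const, integral_indicator_const _ hT.compl, probReal_univ, measureReal_def,
          smul_eq_mul, smul_eq_mul, one_mul, mul_comm]

/-- **Disintegration identity for real integrands from the `[0, ∞]`-valued one**: if
`∫⁻ f dκ₁ = ∫⁻ (∫⁻ f dκ(y)) dκ₂(y)` for all measurable `f ≥ 0` (probability measures), then
`∫ f dκ₁ = ∫ (∫ f dκ(y)) dκ₂(y)` for bounded measurable real `f` with `y ↦ ∫ f dκ(y)` measurable
(shift `f` by its bound and convert with `ofReal_integral_eq_lintegral_ofReal`). [folklore] -/
theorem integral_eq_integral_integral_of_forall_lintegral {X₁ X₂ : Type*}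
    [MeasurableSpace X₁] [MeasurableSpace X₂] {κ₁ : Measure X₁} {κ₂ : Measure X₂}
    [IsProbabilityMeasure κ₁] [IsProbabilityMeasure κ₂] {κ : X₂ → Measure X₁}
    [∀ y, IsProbabilityMeasure (κ y)]
    (hrep : ∀ f : X₁ → ℝ≥0∞, Measurable f → ∫⁻ z, f z ∂κ₁ = ∫⁻ y, ∫⁻ z, f z ∂κ y ∂κ₂)
    {f : X₁ → ℝ} (hf : Measurable f) {C : ℝ} (hC : ∀ z, |f z| ≤ C)
    (hmeas : Measurable fun y ↦ ∫ z, f z ∂κ y) :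
    ∫ z, f z ∂κ₁ = ∫ y, ∫ z, f z ∂κ y ∂κ₂ := by
  have hnn : ∀ z, 0 ≤ f z + C := fun z ↦ by linarith [neg_abs_le (f z), hC z]
  have hint : ∀ (μ : Measure X₁) [IsProbabilityMeasure μ], Integrable f μ := fun μ _ ↦
    MetricFlow.integrable_of_bounded_measurable hf hC
  have hbd : ∀ (μ : Measure X₁) [IsProbabilityMeasure μ], 0 ≤ ∫ z, f z ∂μ + C := fun μ _ ↦ by
    linarith [neg_abs_le (∫ z, f z ∂μ), abs_integral_le_of_forall_abs_le μ hC]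
  have hL : ∀ (μ : Measure X₁) [IsProbabilityMeasure μ],
      ∫⁻ z, ENNReal.ofReal (f z + C) ∂μ = ENNReal.ofReal (∫ z, f z ∂μ + C) := by
    intro μ _
    have hi : Integrable (fun z ↦ f z + C) μ := (hint μ).add (integrable_const C)
    rw [← ofReal_integral_eq_lintegral_ofReal hi (Eventually.of_forall hnn),
      integral_add (hint μ) (integrable_const C), integral_const, probReal_univ, one_smul]
  have key := hrep (fun z ↦ ENNReal.ofReal (f z + C)) (hf.add_const C).ennreal_ofReal
  have hinner : (fun y ↦ ∫⁻ z, ENNReal.ofReal (f z + C) ∂κ y) =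
      fun y ↦ ENNReal.ofReal (∫ z, f z ∂κ y + C) := funext fun y ↦ hL (κ y)
  have hint' : Integrable (fun y ↦ ∫ z, f z ∂κ y) κ₂ :=
    MetricFlow.integrable_of_bounded_measurable hmeas fun y ↦
      abs_integral_le_of_forall_abs_le (κ y) hC
  have hint'' : Integrable (fun y ↦ ∫ z, f z ∂κ y + C) κ₂ := hint'.add (integrable_const C)
  rw [hL κ₁, hinner, ← ofReal_integral_eq_lintegral_ofReal hint''
    (Eventually.of_forall fun y ↦ hbd (κ y)), integral_add hint' (integrable_const C),
    integral_const, probReal_univ, one_smul] at key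
  have h0 : 0 ≤ ∫ y, ∫ z, f z ∂κ y ∂κ₂ + C := by
    linarith [neg_abs_le (∫ y, ∫ z, f z ∂κ y ∂κ₂), abs_integral_le_of_forall_abs_le κ₂
      (fun y ↦ abs_integral_le_of_forall_abs_le (κ y) hC)]
  linarith [(ENNReal.ofReal_eq_ofReal_iff (hbd κ₁) h0).1 key]

variable [MetricSpace X] [BorelSpace X]

/-- **The easy half of Kantorovich–Rubinstein with Lipschitz constant `K`**: for probability
measures `μ, ν` at finite `W₁`-distance and a bounded `K`-Lipschitz `u`,
`|∫ u dμ − ∫ u dν| ≤ K · d_{W₁}(μ, ν)` (apply `ofReal_integral_sub_integral_le_wassersteinW1` to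
`± u / K`; for `K = 0` the function is constant). [cite: Villani2003, Thm. 1.14] -/
theorem abs_integral_sub_integral_le_mul_wassersteinW1 [SecondCountableTopology X]
    (μ ν : Measure X) [IsProbabilityMeasure μ] [IsProbabilityMeasure ν] {u : X → ℝ} {K : ℝ≥0}
    (hu : LipschitzWith K u) {C : ℝ} (hC : ∀ x, |u x| ≤ C) (hfin : wassersteinW1 μ ν ≠ ∞) :
    |∫ x, u x ∂μ - ∫ x, u x ∂ν| ≤ K * (wassersteinW1 μ ν).toReal := by
  rcases eq_or_ne K 0 with rfl | hK
  · -- `u` is constant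
    obtain ⟨x₀⟩ : Nonempty X := μ.nonempty_of_neZero
    have hconst : ∀ x, u x = u x₀ := fun x ↦ by
      have h := hu.dist_le_mul x x₀
      rw [NNReal.coe_zero, zero_mul] at h
      exact dist_le_zero.1 h
    simp only [hconst, integral_const, probReal_univ, one_smul, sub_self, abs_zero, NNReal.coe_zero,
      zero_mul, le_refl]
  have hK0 : (0 : ℝ) < K := NNReal.coe_pos.2 (pos_iff_ne_zero.2 hK)
  -- one-sided bound for every bounded `K`-Lipschitz `w`
  have key : ∀ w : X → ℝ, LipschitzWith K w → (∀ x, |w x| ≤ C) →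
      ∫ x, w x ∂μ - ∫ x, w x ∂ν ≤ K * (wassersteinW1 μ ν).toReal := by
    intro w hw hwC
    have h1 : LipschitzWith 1 fun x ↦ w x / K := LipschitzWith.of_dist_le_mul fun x y ↦ by
      rw [NNReal.coe_one, one_mul, Real.dist_eq, ← sub_div, abs_div, abs_of_pos hK0,
        div_le_iff₀ hK0, mul_comm]
      rw [← Real.dist_eq]
      exact hw.dist_le_mul x y
    have h2 : ∀ x, |w x / K| ≤ C / K := fun x ↦ by
      rw [abs_div, abs_of_pos hK0]
      exact div_le_div_of_nonneg_right (hwC x) hK0.le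
    have h3 := ofReal_integral_sub_integral_le_wassersteinW1 μ ν
      (hw.continuous.measurable.div_const _) h2 h1
    rw [ENNReal.ofReal_le_iff_le_toReal hfin, integral_div, integral_div, ← sub_div,
      div_le_iff₀ hK0] at h3
    linarith
  have hpos := key u hu hC
  have hneg := key (-u) hu.neg fun x ↦ by rw [Pi.neg_apply, abs_neg]; exact hC x
  simp only [Pi.neg_apply, integral_neg] at hneg
  exact abs_sub_le_iff.2 ⟨hpos, by linarith⟩

/-- **Integrals of bounded Lipschitz functions converge under `W₁`-convergence**: if
`d_{W₁}(αᵢ, α) → 0` then `∫ u dαᵢ → ∫ u dα` for every bounded Lipschitz `u`.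
[cite: Villani2003, §7.1] -/
theorem tendsto_integral_of_tendsto_wassersteinW1_zero [SecondCountableTopology X]
    {ι : Type*} {l : Filter ι} {α : ι → Measure X} {αinf : Measure X}
    [∀ i, IsProbabilityMeasure (α i)] [IsProbabilityMeasure αinf]
    (hα : Tendsto (fun i ↦ wassersteinW1 (α i) αinf) l (𝓝 0)) {u : X → ℝ} {K : ℝ≥0}
    (hu : LipschitzWith K u) {C : ℝ} (hC : ∀ x, |u x| ≤ C) :
    Tendsto (fun i ↦ ∫ x, u x ∂α i) l (𝓝 (∫ x, u x ∂αinf)) := by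
  rw [tendsto_iff_dist_tendsto_zero]
  have hfin : ∀ᶠ i in l, wassersteinW1 (α i) αinf < ∞ := hα.eventually_lt_const ENNReal.zero_lt_top
  have hto : Tendsto (fun i ↦ (K : ℝ) * (wassersteinW1 (α i) αinf).toReal) l (𝓝 0) := by
    have h := ((ENNReal.tendsto_toReal ENNReal.zero_ne_top).comp hα).const_mul (K : ℝ)
    rwa [ENNReal.toReal_zero, mul_zero] at h
  refine squeeze_zero' (Eventually.of_forall fun i ↦ dist_nonneg) ?_ hto
  filter_upwards [hfin] with i hi
  rw [Real.dist_eq]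
  exact abs_integral_sub_integral_le_mul_wassersteinW1 _ _ hu hC hi.ne

end Toolbox

/-! ### Lipschitz extension and the uniform estimate on thickened compact sets -/

/-- A bounded `K`-Lipschitz function on a subset extends to a `K`-Lipschitz function with the
same bound (McShane extension, clamped). [folklore] -/
theorem exists_lipschitzWith_extension_abs_le {Z : Type*} [PseudoMetricSpace Z]
    {s : Set Z} {f : Z → ℝ} {K : ℝ≥0} (hf : LipschitzOnWith K f s) {C : ℝ} (hC0 : 0 ≤ C)
    (hC : ∀ z ∈ s, |f z| ≤ C) :
    ∃ F : Z → ℝ, LipschitzWith K F ∧ (∀ z, |F z| ≤ C) ∧ EqOn f F s := by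
  obtain ⟨F₀, hF₀, hEq⟩ := hf.extend_real
  refine ⟨fun z ↦ max (-C) (min C (F₀ z)), (hF₀.const_min C).const_max (-C), fun z ↦
    abs_le.2 ⟨le_max_left _ _, max_le (by linarith) (min_le_left _ _)⟩, fun z hz ↦ ?_⟩
  obtain ⟨h1, h2⟩ := abs_le.1 (hC z hz)
  show f z = max (-C) (min C (F₀ z))
  rw [← hEq hz, min_eq_right h2, max_eq_right h1]

/-- **From convergence along approximating sequences to a uniform estimate** (the quantitative
content of "for any sequence `yⁱ ∈ 𝒳ⁱ_{t₂}` with `φⁱ_{t₂}(yⁱ) → y^∞` we have `hⁱ(yⁱ) → h^∞(y^∞)`"):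
if the `hⁿ : Xₙ → ℝ` are uniformly `K`-Lipschitz, `H` is `K`-Lipschitz, and every point `a` of `S`
is the limit of some `φₙ(yₙ)` with `hⁿ(yₙ) → H(a)`, then for every compact `K_c ⊆ S` and `ε > 0`
there is `δ > 0` with `|hⁿ(y) − H(φₙ y)| ≤ ε` whenever `φₙ(y)` is `δ`-close to `K_c` and `n` is
large (finite `δ`-net of `K_c`).
[cite: Bamler2023, §5.4, Lemma 5.20, proof of Claim 5.22 (arXiv v1 Claim 123)] -/
theorem exists_eventually_forall_abs_sub_le_of_mem_thickening {Z : Type*} [MetricSpace Z]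
    {X : ℕ → Type*} [∀ n, MetricSpace (X n)] (φ : ∀ n, X n → Z) (hφ : ∀ n, Isometry (φ n))
    (h : ∀ n, X n → ℝ)
    {K : ℝ≥0} (hh : ∀ n, LipschitzWith K (h n)) (H : Z → ℝ) (hH : LipschitzWith K H) {S : Set Z}
    (hS : ∀ a ∈ S, ∃ yn : ∀ n, X n, Tendsto (fun n ↦ φ n (yn n)) atTop (𝓝 a) ∧
      Tendsto (fun n ↦ h n (yn n)) atTop (𝓝 (H a)))
    {Kc : Set Z} (hKc : IsCompact Kc) (hKcS : Kc ⊆ S) {ε : ℝ} (hε : 0 < ε) :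
    ∃ δ > 0, ∀ᶠ n in atTop, ∀ y : X n, φ n y ∈ thickening δ Kc → |h n y - H (φ n y)| ≤ ε := by
  have hK0 : (0 : ℝ) ≤ K := K.coe_nonneg
  set δ : ℝ := ε / (10 * (K + 1)) with hδ_def
  have hδ : 0 < δ := by positivity
  have h5 : 5 * K * δ ≤ ε / 2 := by
    have h1 : (K : ℝ) / (K + 1) ≤ 1 := (div_le_one (by positivity)).2 (by linarith)
    calc 5 * K * δ = ε / 2 * (K / (K + 1)) := by rw [hδ_def]; field_simp; ring
      _ ≤ ε / 2 * 1 := by gcongr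
      _ = ε / 2 := mul_one _
  refine ⟨δ, hδ, ?_⟩
  obtain ⟨t, htKc, ht, hcover⟩ := hKc.finite_cover_balls hδ
  choose yn hφyn hhyn using hS
  have hev : ∀ᶠ n in atTop, ∀ a ∈ t, ∀ ha : a ∈ S,
      dist (φ n (yn a ha n)) a < δ ∧ |h n (yn a ha n) - H a| < ε / 2 := by
    refine ht.eventually_all.2 fun a hat ↦ ?_
    have ha : a ∈ S := hKcS (htKc hat)
    have h1 : ∀ᶠ n in atTop, dist (φ n (yn a ha n)) a < δ := Metric.tendsto_nhds.1 (hφyn a ha) δ hδ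
    have h2 : ∀ᶠ n in atTop, |h n (yn a ha n) - H a| < ε / 2 := by
      have h := Metric.tendsto_nhds.1 (hhyn a ha) (ε / 2) (half_pos hε)
      simpa only [Real.dist_eq] using h
    filter_upwards [h1, h2] with n h1n h2n
    exact fun _ ↦ ⟨h1n, h2n⟩
  filter_upwards [hev] with n hn
  intro y hy
  obtain ⟨k, hk, hyk⟩ := mem_thickening_iff.1 hy
  obtain ⟨a, hat, hka⟩ : ∃ a ∈ t, k ∈ ball a δ := by
    simpa only [mem_iUnion, exists_prop] using hcover hk
  have ha : a ∈ S := hKcS (htKc hat)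
  obtain ⟨h1n, h2n⟩ := hn a hat ha
  rw [mem_ball] at hka
  have hd1 : dist (φ n y) a < 2 * δ := by linarith [dist_triangle (φ n y) k a]
  have hd2 : dist y (yn a ha n) < 3 * δ := by
    rw [← (hφ n).dist_eq]
    linarith [dist_triangle_right (φ n y) (φ n (yn a ha n)) a]
  have e1 : |h n y - h n (yn a ha n)| ≤ K * (3 * δ) := by
    rw [← Real.dist_eq]
    exact ((hh n).dist_le_mul _ _).trans (by gcongr)
  have e3 : |H a - H (φ n y)| ≤ K * (2 * δ) := by
    rw [← Real.dist_eq]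
    refine (hH.dist_le_mul _ _).trans ?_
    rw [dist_comm]
    gcongr
  calc |h n y - H (φ n y)|
      ≤ |h n y - h n (yn a ha n)| + |h n (yn a ha n) - H a| + |H a - H (φ n y)| :=
        (abs_sub_le _ (H a) _).trans (by linarith [abs_sub_le (h n y) (h n (yn a ha n)) (H a)])
    _ ≤ K * (3 * δ) + ε / 2 + K * (2 * δ) := by linarith [h2n.le]
    _ ≤ ε := by linarith

end Literature.Geometry.Riemannian

end
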